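import Literature.NumberTheory.Automorphic.ParabolicBruhatCellSupport
import Literature.NumberTheory.Automorphic.InducedWhittakerVanishing
import HarnessLib

/-!
# The Bruhat cells `B P_σ U_n` of `GL_n`: torus coordinates, the Gelfand–Kazhdan involution, and
the closed filtration by rank sums

Topic `NumberTheory/Automorphic`. Structural input for the Gelfand–Kazhdan analysis of
bi-`ψ_U`-quasi-invariant distributions on `GL_n(F)` (Gelfand–Kazhdan 1975, §§3–4;
Bernstein–Zelevinsky 1976, §§5.16–5.19 and §7; Bump 1997, §4.4 for `n = 2`), carried out for the
Borel cells `C_σ = B P_σ U_n` (`parabolicDoubleCoset id σ` of `ParabolicBruhatCellsGL` with the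
trivial block labelling `c = id`, `B = standardParabolicGL K id` the invertible upper triangular
matrices, `U_n = upperUnitriangular`, `P_σ = permGL σ`):

* **Torus coordinate.** Every `g ∈ C_σ` is `u₁ d P_σ u₂` with `u₁, u₂ ∈ U_n` and `d` diagonal, and
  the diagonal part `d` is determined by `g` (`diagEntries_eq_of_mul_permGL_mul_eq`, uniqueness of
  the monomial representative `d P_σ` of a `(U_n, U_n)`-double coset): `cellDiag σ g` (junk `0` off
  the cell) and its invertible form `cellTorus σ g = diag(cellDiag σ g)`. It is invariant under
  `g ↦ u₁ g u₂` (`cellTorus_mul_mul`) and its fibres are exactly the `(U_n × U_n)`-orbits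
  (`exists_eq_mul_mul_of_cellTorus_eq`); `g = u₁ (cellTorus σ g) P_σ u₂` (`exists_eq_mul_cellTorus_mul`).
* **The Gelfand–Kazhdan involution** `ι(g) = w⁰ ᵗg w⁰` (`gkInvolution`) maps `B` to `B`, `P_σ` to
  `P_{σ⋆}` with `σ⋆ = rev σ⁻¹ rev` (`starPerm`), diagonal matrices to diagonal matrices
  (`gkInvolution_diagonalGL`), hence `ι(C_σ) = C_{σ⋆}` (`gkInvolution_mem_bruhatCell_iff`); when
  `σ⋆ = σ` the torus coordinate of `ι(g)` is the conjugate of that of `g` by the involution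
  `m₀ = P_σ w⁰` (`cellTorus_gkInvolution`, `cellSharp`).
* **The closed filtration.** `levelLT r = ⋃_{rankSum σ < r} C_σ` is closed
  (`isClosed_levelLT`, the tree's `isClosed_cellsBelow` for the lower set `{rankSum < r}` of keys),
  stable under `(u₁, u₂)` and under `ι` (`rankSum_starPerm`: the rank sum
  `∑_{a, j} #{i ≥ a : σ i < j} = ∑_i (i + 1)(n - σ i)` is `ι`-invariant), exhausts `GL_n`
  (`levelLT_eq_univ`), satisfies `levelLT (r+1) = levelLT r ∪ ⋃_{rankSum τ = r} C_τ`
  (`mem_levelLT_succ_iff`), and each cell `C_σ` is relatively open in `levelLT (rankSum σ + 1)`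
  (`exists_isOpen_inter_levelLT_subset`, by the lower semicontinuity of the south-west ranks, as in
  `isClosed_cellsBelow`).
* **Over a local field**: the torus coordinate is continuous on the cell
  (`continuousOn_cellTorus`, through the open orbit map `isOpenMap_parabolicCellAction`), and a
  compact subset of a cell is uniformly compact in both unipotent directions
  (`exists_isCompact_forall_eq_mul_cellTorus_mul`, from
  `exists_isCompact_subset_parabolic_mul_permGL_mul`).

Everything is a definition with a body (`diagEntries`, `borelTorus`, `cellDiag`, `cellTorus`,
`starPerm`, `cellSharpElt`, `cellSharp`, `levelLT`) or a proved theorem; no named fact is introduced.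

## References

* I. M. Gelfand, D. A. Kazhdan, *Representations of the group GL(n, K) where K is a local field*,
  in: Lie groups and their representations (Budapest 1971), Halsted (1975), 95–118, §§3–4.
  [GelfandKazhdan1975]
* I. N. Bernstein, A. V. Zelevinsky, *Representations of the group GL(n, F) where F is a
  non-archimedean local field*, Russian Math. Surveys 31:3 (1976), 1–68, §§5.16–5.19, §7.
  [BernsteinZelevinskyRMS1976]
* D. Bump, *Automorphic Forms and Representations* (1997), §4.4, proof of Theorem 4.4.2 for
  `GL(2)` (pp. 456–457: the cells `B` and `B w B`). [Bump1997]
* W. Fulton, *Young Tableaux* (1997), §10.2 (closures of Bruhat cells). [FultonYoungTableaux1997]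
-/

open Matrix

namespace Literature.NumberTheory.Automorphic

/-! ### Diagonal entries of triangular matrices -/

section Field

variable {K : Type*} [Field K] {n : ℕ}

/-- The Borel cell `C_σ = B P_σ U_n ⊆ GL_n(K)` (`parabolicDoubleCoset` for the trivial labelling
`c = id`). An `abbrev`. [folklore] -/
abbrev bruhatCell (σ : Equiv.Perm (Fin n)) : Set (GL (Fin n) K) :=
  parabolicDoubleCoset (K := K) (_root_.id : Fin n → Fin n) σ

/-- The diagonal entries `i ↦ g_{ii}` of an invertible matrix. [folklore] -/
def diagEntries (g : GL (Fin n) K) : Fin n → K := fun i => (g : Matrix (Fin n) (Fin n) K) i i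

/-- Unfolding lemma for `diagEntries`. [folklore] -/
@[simp] lemma diagEntries_apply (g : GL (Fin n) K) (i : Fin n) :
    diagEntries g i = (g : Matrix (Fin n) (Fin n) K) i i := rfl

/-- The diagonal of a product of upper triangular matrices is the product of the diagonals.
[folklore] -/
theorem mul_apply_diag_of_blockTriangular {M N : Matrix (Fin n) (Fin n) K}
    (hM : M.BlockTriangular _root_.id) (hN : N.BlockTriangular _root_.id) (i : Fin n) :
    (M * N) i i = M i i * N i i := by
  rw [Matrix.mul_apply]
  refine Finset.sum_eq_single i (fun k _ hk => ?_) (fun h => absurd (Finset.mem_univ i) h)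
  rcases lt_or_gt_of_ne hk with h | h
  · rw [hM h, zero_mul]
  · rw [hN h, mul_zero]

/-- `U_n ≤ B`. [folklore] -/
lemma upperUnitriangular_le_borel :
    upperUnitriangular (Fin n) K ≤ standardParabolicGL K (_root_.id : Fin n → Fin n) :=
  fun _ hu => blockTriangular_of_mem_upperUnitriangular hu

/-- `diag(u b) = diag(b)` for `u ∈ U_n`, `b ∈ B`. [folklore] -/
theorem diagEntries_upperUnitriangular_mul {u b : GL (Fin n) K} (hu : u ∈ upperUnitriangular (Fin n) K)
    (hb : b ∈ standardParabolicGL K (_root_.id : Fin n → Fin n)) :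
    diagEntries (u * b) = diagEntries b := by
  funext i
  rw [diagEntries_apply, Units.val_mul,
    mul_apply_diag_of_blockTriangular (blockTriangular_of_mem_upperUnitriangular hu) hb,
    ((mem_upperUnitriangular_iff u).1 hu).2 i, one_mul, diagEntries_apply]

/-- `diag(b u) = diag(b)` for `u ∈ U_n`, `b ∈ B`. [folklore] -/
theorem diagEntries_mul_upperUnitriangular {b u : GL (Fin n) K}
    (hb : b ∈ standardParabolicGL K (_root_.id : Fin n → Fin n)) (hu : u ∈ upperUnitriangular (Fin n) K) :
    diagEntries (b * u) = diagEntries b := by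
  funext i
  rw [diagEntries_apply, Units.val_mul,
    mul_apply_diag_of_blockTriangular hb (blockTriangular_of_mem_upperUnitriangular hu),
    ((mem_upperUnitriangular_iff u).1 hu).2 i, mul_one, diagEntries_apply]

/-- `diag(b b') = diag(b) diag(b')` on `B`. [folklore] -/
theorem diagEntries_mul {b b' : GL (Fin n) K}
    (hb : b ∈ standardParabolicGL K (_root_.id : Fin n → Fin n))
    (hb' : b' ∈ standardParabolicGL K (_root_.id : Fin n → Fin n)) :
    diagEntries (b * b') = diagEntries b * diagEntries b' := by
  funext i
  rw [diagEntries_apply, Units.val_mul, mul_apply_diag_of_blockTriangular hb hb', Pi.mul_apply,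
    diagEntries_apply, diagEntries_apply]

/-- The diagonal entries of `b ∈ B` are non-zero (`det b = ∏ b_{ii}`). [folklore] -/
theorem diagEntries_ne_zero {b : GL (Fin n) K}
    (hb : b ∈ standardParabolicGL K (_root_.id : Fin n → Fin n)) (i : Fin n) : diagEntries b i ≠ 0 := by
  have hdet : (b : Matrix (Fin n) (Fin n) K).det ≠ 0 := (Matrix.isUnits_det_units b).ne_zero
  rw [Matrix.det_of_upperTriangular hb] at hdet
  exact fun h => hdet (Finset.prod_eq_zero (Finset.mem_univ i) h)

/-- The diagonal matrix `diag(b_{ii})` of `b ∈ B`, as an element of `GL_n(K)`. [folklore] -/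
noncomputable def borelTorus (b : GL (Fin n) K)
    (hb : b ∈ standardParabolicGL K (_root_.id : Fin n → Fin n)) : GL (Fin n) K :=
  diagonalGL (Fin n) K fun i => Units.mk0 (diagEntries b i) (diagEntries_ne_zero hb i)

/-- The matrix of `borelTorus b`. [folklore] -/
@[simp] lemma coe_borelTorus (b : GL (Fin n) K)
    (hb : b ∈ standardParabolicGL K (_root_.id : Fin n → Fin n)) :
    ((borelTorus b hb : GL (Fin n) K) : Matrix (Fin n) (Fin n) K) = Matrix.diagonal (diagEntries b) := by
  rw [borelTorus, coe_diagonalGL]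
  rfl

/-- Diagonal invertible matrices lie in `B`. [folklore] -/
lemma diagonalGL_mem_borel (d : Fin n → Kˣ) :
    diagonalGL (Fin n) K d ∈ standardParabolicGL K (_root_.id : Fin n → Fin n) := by
  intro i j hij
  rw [coe_diagonalGL]
  exact Matrix.diagonal_apply_ne _ (ne_of_gt hij)

/-- `diag` of a diagonal matrix. [folklore] -/
@[simp] lemma diagEntries_diagonalGL (d : Fin n → Kˣ) :
    diagEntries (diagonalGL (Fin n) K d) = fun i => (d i : K) := by
  funext i
  rw [diagEntries_apply, coe_diagonalGL, Matrix.diagonal_apply_eq]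

/-- **`B = U_n · D`**: `b · diag(b)⁻¹ ∈ U_n` for `b ∈ B`. [folklore] -/
theorem mul_borelTorus_inv_mem_upperUnitriangular {b : GL (Fin n) K}
    (hb : b ∈ standardParabolicGL K (_root_.id : Fin n → Fin n)) :
    b * (borelTorus b hb)⁻¹ ∈ upperUnitriangular (Fin n) K := by
  have hd : (borelTorus b hb)⁻¹ ∈ standardParabolicGL K (_root_.id : Fin n → Fin n) :=
    Subgroup.inv_mem _ (diagonalGL_mem_borel _)
  rw [mem_upperUnitriangular_iff]
  refine ⟨Subgroup.mul_mem _ hb hd, fun i => ?_⟩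
  rw [Units.val_mul, mul_apply_diag_of_blockTriangular hb hd, borelTorus, ← map_inv, coe_diagonalGL,
    Matrix.diagonal_apply_eq, Pi.inv_apply, Units.val_inv_eq_inv_val, Units.val_mk0]
  exact mul_inv_cancel₀ (diagEntries_ne_zero hb i)

/-- **`B = D · U_n`**: `diag(b)⁻¹ · b ∈ U_n` for `b ∈ B`. [folklore] -/
theorem borelTorus_inv_mul_mem_upperUnitriangular {b : GL (Fin n) K}
    (hb : b ∈ standardParabolicGL K (_root_.id : Fin n → Fin n)) :
    (borelTorus b hb)⁻¹ * b ∈ upperUnitriangular (Fin n) K := by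
  have hd : (borelTorus b hb)⁻¹ ∈ standardParabolicGL K (_root_.id : Fin n → Fin n) :=
    Subgroup.inv_mem _ (diagonalGL_mem_borel _)
  rw [mem_upperUnitriangular_iff]
  refine ⟨Subgroup.mul_mem _ hd hb, fun i => ?_⟩
  rw [Units.val_mul, mul_apply_diag_of_blockTriangular hd hb, borelTorus, ← map_inv, coe_diagonalGL,
    Matrix.diagonal_apply_eq, Pi.inv_apply, Units.val_inv_eq_inv_val, Units.val_mk0]
  exact inv_mul_cancel₀ (diagEntries_ne_zero hb i)

/-! ### Permutation matrices: conjugation of diagonal matrices -/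

/-- Entries of `P_ρ M P_τ`: `(P_ρ M P_τ)_{ij} = M_{ρ i, τ⁻¹ j}`. [folklore] -/
theorem permGL_mul_mul_permGL_apply (ρ τ : Equiv.Perm (Fin n)) (M : Matrix (Fin n) (Fin n) K)
    (i j : Fin n) :
    (((permGL ρ : GL (Fin n) K) : Matrix (Fin n) (Fin n) K) * M *
        ((permGL τ : GL (Fin n) K) : Matrix (Fin n) (Fin n) K)) i j = M (ρ i) (τ.symm j) := by
  have h1 : ∀ l, (((permGL ρ : GL (Fin n) K) : Matrix (Fin n) (Fin n) K) * M) i l = M (ρ i) l := by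
    intro l
    rw [Matrix.mul_apply, Finset.sum_eq_single (ρ i)]
    · rw [coe_permGL, permMatrix_apply', if_pos rfl, one_mul]
    · intro k _ hk
      rw [coe_permGL, permMatrix_apply', if_neg (Ne.symm hk), zero_mul]
    · exact fun h => absurd (Finset.mem_univ _) h
  rw [Matrix.mul_apply, Finset.sum_eq_single (τ.symm j)]
  · rw [h1, coe_permGL τ, permMatrix_apply', if_pos (Equiv.apply_symm_apply τ j), mul_one]
  · intro l _ hl
    rw [coe_permGL τ, permMatrix_apply', if_neg (fun h => hl ?_), mul_zero]
    rw [← h, Equiv.symm_apply_apply]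
  · exact fun h => absurd (Finset.mem_univ _) h

/-- **Conjugating a diagonal matrix by a permutation matrix permutes its entries**:
`P_σ diag(d) P_σ⁻¹ = diag(d ∘ σ)`. [folklore] -/
theorem permGL_mul_diagonalGL_mul_permGL_inv (σ : Equiv.Perm (Fin n)) (d : Fin n → Kˣ) :
    (permGL σ : GL (Fin n) K) * diagonalGL (Fin n) K d * (permGL σ)⁻¹ =
      diagonalGL (Fin n) K (d ∘ σ) := by
  apply Units.ext
  ext i j
  rw [permGL_inv, Units.val_mul, Units.val_mul, coe_diagonalGL, permGL_mul_mul_permGL_apply,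
    coe_diagonalGL, Equiv.Perm.inv_def, Equiv.symm_symm]
  by_cases h : i = j
  · subst h
    rw [Matrix.diagonal_apply_eq, Matrix.diagonal_apply_eq, Function.comp_apply]
  · rw [Matrix.diagonal_apply_ne _ (fun h' => h (σ.injective h')), Matrix.diagonal_apply_ne _ h]

/-! ### Uniqueness of the diagonal part of a monomial representative -/

/-- **Uniqueness of the torus part**: if `b P_σ u = b' P_σ u'` with `b, b' ∈ B`, `u, u' ∈ U_n`, then
`diag(b) = diag(b')` (the monomial matrix `d P_σ` representing a `(U_n, U_n)`-double coset inside
the cell is unique; Bump 1997, p. 456, the representatives of `B \ G / B`). [folklore] -/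
theorem diagEntries_eq_of_mul_permGL_mul_eq (σ : Equiv.Perm (Fin n)) {b b' u u' : GL (Fin n) K}
    (hb : b ∈ standardParabolicGL K (_root_.id : Fin n → Fin n))
    (hb' : b' ∈ standardParabolicGL K (_root_.id : Fin n → Fin n))
    (hu : u ∈ upperUnitriangular (Fin n) K) (hu' : u' ∈ upperUnitriangular (Fin n) K)
    (h : b * permGL σ * u = b' * permGL σ * u') : diagEntries b = diagEntries b' := by
  -- `P_σ⁻¹ (b'⁻¹ b) P_σ = u' u⁻¹ ∈ U_n`
  set c := b'⁻¹ * b with hc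
  have hcB : c ∈ standardParabolicGL K (_root_.id : Fin n → Fin n) :=
    Subgroup.mul_mem _ (Subgroup.inv_mem _ hb') hb
  have hconj : (permGL σ : GL (Fin n) K)⁻¹ * c * permGL σ = u' * u⁻¹ := by
    rw [hc]
    have : b = b' * permGL σ * u' * u⁻¹ * (permGL σ)⁻¹ := by
      rw [← h]; group
    rw [this]; group
  have hU : (permGL σ : GL (Fin n) K)⁻¹ * c * permGL σ ∈ upperUnitriangular (Fin n) K := by
    rw [hconj]
    exact Subgroup.mul_mem _ hu' (Subgroup.inv_mem _ hu)
  -- diagonal entries: `c_{σ⁻¹ i σ⁻¹ i} = 1`, i.e. `c_{kk} = 1`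
  have hdiag : ∀ k, (c : Matrix (Fin n) (Fin n) K) k k = 1 := by
    intro k
    have h1 := ((mem_upperUnitriangular_iff _).1 hU).2 (σ k)
    rw [permGL_inv, Units.val_mul, Units.val_mul, permGL_mul_mul_permGL_apply] at h1
    simpa using h1
  -- `diag(b) = diag(b') diag(c) = diag(b')`
  have hbc : b = b' * c := by rw [hc, mul_inv_cancel_left]
  funext i
  rw [hbc, diagEntries_mul hb' hcB, Pi.mul_apply, diagEntries_apply c, hdiag i, mul_one]

/-! ### The torus coordinate of a cell -/

/-- The **torus coordinate** of the cell `C_σ = B P_σ U_n`: for `g = b P_σ u` the diagonal entries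
of `b` (well defined by `diagEntries_eq_of_mul_permGL_mul_eq`); junk value `0` off the cell.
[folklore] -/
noncomputable def cellDiag (σ : Equiv.Perm (Fin n)) (g : GL (Fin n) K) : Fin n → K :=
  by classical exact if h : g ∈ bruhatCell (K := K) σ then diagEntries (Classical.choose h) else 0

/-- **The torus coordinate of `b P_σ u` is `diag(b)`.** [folklore] -/
theorem cellDiag_eq (σ : Equiv.Perm (Fin n)) {b u : GL (Fin n) K}
    (hb : b ∈ standardParabolicGL K (_root_.id : Fin n → Fin n)) (hu : u ∈ upperUnitriangular (Fin n) K) :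
    cellDiag σ (b * permGL σ * u) = diagEntries b := by
  classical
  have h : b * permGL σ * u ∈ bruhatCell (K := K) σ := ⟨b, hb, u, hu, rfl⟩
  rw [cellDiag, dif_pos h]
  obtain ⟨hb', u', hu', h'⟩ := Classical.choose_spec h
  exact (diagEntries_eq_of_mul_permGL_mul_eq σ hb (hb') hu hu' h').symm

/-- The torus coordinate does not vanish on the cell. [folklore] -/
theorem cellDiag_ne_zero (σ : Equiv.Perm (Fin n)) {g : GL (Fin n) K} (hg : g ∈ bruhatCell (K := K) σ)
    (i : Fin n) : cellDiag σ g i ≠ 0 := by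
  obtain ⟨b, hb, u, hu, rfl⟩ := hg
  rw [cellDiag_eq σ hb hu]
  exact diagEntries_ne_zero hb i

/-- The torus coordinate as an invertible diagonal matrix `cellTorus σ g = diag(cellDiag σ g)`
(the identity off the cell). [folklore] -/
noncomputable def cellTorus (σ : Equiv.Perm (Fin n)) (g : GL (Fin n) K) : GL (Fin n) K :=
  by classical exact
    if h : g ∈ bruhatCell (K := K) σ then
      diagonalGL (Fin n) K fun i => Units.mk0 (cellDiag σ g i) (cellDiag_ne_zero σ h i)
    else 1

/-- On the cell, the matrix of `cellTorus σ g` is `diag(cellDiag σ g)`. [folklore] -/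
theorem coe_cellTorus (σ : Equiv.Perm (Fin n)) {g : GL (Fin n) K} (hg : g ∈ bruhatCell (K := K) σ) :
    ((cellTorus σ g : GL (Fin n) K) : Matrix (Fin n) (Fin n) K) = Matrix.diagonal (cellDiag σ g) := by
  classical
  rw [cellTorus, dif_pos hg, coe_diagonalGL]
  rfl

/-- **`cellTorus (b P_σ u) = diag(b)`** as invertible matrices. [folklore] -/
theorem cellTorus_eq (σ : Equiv.Perm (Fin n)) {b u : GL (Fin n) K}
    (hb : b ∈ standardParabolicGL K (_root_.id : Fin n → Fin n)) (hu : u ∈ upperUnitriangular (Fin n) K) :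
    cellTorus σ (b * permGL σ * u) = borelTorus b hb := by
  apply Units.ext
  rw [coe_cellTorus σ ⟨b, hb, u, hu, rfl⟩, cellDiag_eq σ hb hu, coe_borelTorus]

/-- `cellTorus σ g` is a diagonal invertible matrix, in particular lies in `B`. [folklore] -/
theorem cellTorus_mem_borel (σ : Equiv.Perm (Fin n)) (g : GL (Fin n) K) :
    cellTorus σ g ∈ standardParabolicGL K (_root_.id : Fin n → Fin n) := by
  classical
  by_cases hg : g ∈ bruhatCell (K := K) σ
  · rw [cellTorus, dif_pos hg]; exact diagonalGL_mem_borel _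
  · rw [cellTorus, dif_neg hg]; exact Subgroup.one_mem _

/-- `cellTorus σ g` is in the range of `diagonalGL`. [folklore] -/
theorem exists_diagonalGL_eq_cellTorus (σ : Equiv.Perm (Fin n)) (g : GL (Fin n) K) :
    ∃ d : Fin n → Kˣ, diagonalGL (Fin n) K d = cellTorus σ g := by
  classical
  by_cases hg : g ∈ bruhatCell (K := K) σ
  · exact ⟨_, by rw [cellTorus, dif_pos hg]⟩
  · exact ⟨1, by rw [cellTorus, dif_neg hg, map_one]⟩

/-- **Every point of the cell is `u₁ (d P_σ) u₂`** with `d` its torus coordinate and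
`u₁, u₂ ∈ U_n` (`b = (b d⁻¹) d`). [folklore] -/
theorem exists_eq_mul_cellTorus_mul (σ : Equiv.Perm (Fin n)) {g : GL (Fin n) K}
    (hg : g ∈ bruhatCell (K := K) σ) :
    ∃ u₁ ∈ upperUnitriangular (Fin n) K, ∃ u₂ ∈ upperUnitriangular (Fin n) K,
      g = u₁ * (cellTorus σ g * permGL σ) * u₂ := by
  obtain ⟨b, hb, u, hu, rfl⟩ := hg
  refine ⟨b * (borelTorus b hb)⁻¹, mul_borelTorus_inv_mem_upperUnitriangular hb, u, hu, ?_⟩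
  rw [cellTorus_eq σ hb hu, ← mul_assoc (b * (borelTorus b hb)⁻¹), inv_mul_cancel_right]

/-- **Invariance**: `cellTorus σ (u₁ g u₂) = cellTorus σ g` for `u₁, u₂ ∈ U_n` and `g` in the cell.
[folklore] -/
theorem cellTorus_mul_mul (σ : Equiv.Perm (Fin n)) {g u₁ u₂ : GL (Fin n) K}
    (hg : g ∈ bruhatCell (K := K) σ) (hu₁ : u₁ ∈ upperUnitriangular (Fin n) K)
    (hu₂ : u₂ ∈ upperUnitriangular (Fin n) K) : cellTorus σ (u₁ * g * u₂) = cellTorus σ g := by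
  obtain ⟨b, hb, u, hu, rfl⟩ := hg
  have hub : u₁ * b ∈ standardParabolicGL K (_root_.id : Fin n → Fin n) :=
    Subgroup.mul_mem _ (upperUnitriangular_le_borel hu₁) hb
  have : u₁ * (b * permGL σ * u) * u₂ = (u₁ * b) * permGL σ * (u * u₂) := by group
  rw [this, cellTorus_eq σ hub (Subgroup.mul_mem _ hu hu₂), cellTorus_eq σ hb hu]
  apply Units.ext
  rw [coe_borelTorus, coe_borelTorus, diagEntries_upperUnitriangular_mul hu₁ hb]

/-- The cell is stable under `g ↦ u₁ g u₂`. [folklore] -/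
theorem mul_mul_mem_bruhatCell (σ : Equiv.Perm (Fin n)) {g u₁ u₂ : GL (Fin n) K}
    (hg : g ∈ bruhatCell (K := K) σ) (hu₁ : u₁ ∈ upperUnitriangular (Fin n) K)
    (hu₂ : u₂ ∈ upperUnitriangular (Fin n) K) : u₁ * g * u₂ ∈ bruhatCell (K := K) σ :=
  mul_mul_mem_parabolicDoubleCoset _ hg (upperUnitriangular_le_borel hu₁) hu₂

/-- **The fibres of the torus coordinate are the `(U_n, U_n)`-double cosets**: two points of the
cell with the same torus coordinate differ by `g' = u₁ g u₂`. [folklore] -/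
theorem exists_eq_mul_mul_of_cellTorus_eq (σ : Equiv.Perm (Fin n)) {g g' : GL (Fin n) K}
    (hg : g ∈ bruhatCell (K := K) σ) (hg' : g' ∈ bruhatCell (K := K) σ)
    (h : cellTorus σ g = cellTorus σ g') :
    ∃ u₁ ∈ upperUnitriangular (Fin n) K, ∃ u₂ ∈ upperUnitriangular (Fin n) K, g' = u₁ * g * u₂ := by
  obtain ⟨v₁, hv₁, v₂, hv₂, hgv⟩ := exists_eq_mul_cellTorus_mul σ hg
  obtain ⟨w₁, hw₁, w₂, hw₂, hgw⟩ := exists_eq_mul_cellTorus_mul σ hg'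
  refine ⟨w₁ * v₁⁻¹, Subgroup.mul_mem _ hw₁ (Subgroup.inv_mem _ hv₁), v₂⁻¹ * w₂,
    Subgroup.mul_mem _ (Subgroup.inv_mem _ hv₂) hw₂, ?_⟩
  calc g' = w₁ * (cellTorus σ g' * permGL σ) * w₂ := hgw
    _ = w₁ * (cellTorus σ g * permGL σ) * w₂ := by rw [h]
    _ = w₁ * (v₁⁻¹ * (v₁ * (cellTorus σ g * permGL σ) * v₂) * v₂⁻¹) * w₂ := by group
    _ = w₁ * (v₁⁻¹ * g * v₂⁻¹) * w₂ := by rw [← hgv]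
    _ = w₁ * v₁⁻¹ * g * (v₂⁻¹ * w₂) := by group

/-- The monomial representative `(cellTorus σ g) P_σ` lies in the cell and has the same torus
coordinate. [folklore] -/
theorem cellTorus_mul_permGL_mem (σ : Equiv.Perm (Fin n)) (g : GL (Fin n) K) :
    cellTorus σ g * permGL σ ∈ bruhatCell (K := K) σ :=
  ⟨_, cellTorus_mem_borel σ g, 1, Subgroup.one_mem _, by rw [mul_one]⟩

/-- `cellTorus σ (d P_σ) = d` for the representative `d = cellTorus σ g`. [folklore] -/
theorem cellTorus_cellTorus_mul_permGL (σ : Equiv.Perm (Fin n)) {g : GL (Fin n) K}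
    (hg : g ∈ bruhatCell (K := K) σ) : cellTorus σ (cellTorus σ g * permGL σ) = cellTorus σ g := by
  obtain ⟨u₁, hu₁, u₂, hu₂, h⟩ := exists_eq_mul_cellTorus_mul σ hg
  calc cellTorus σ (cellTorus σ g * permGL σ)
      = cellTorus σ (u₁ * (cellTorus σ g * permGL σ) * u₂) :=
        (cellTorus_mul_mul σ (cellTorus_mul_permGL_mem σ g) hu₁ hu₂).symm
    _ = cellTorus σ g := by rw [← h]

/-! ### The permutation `σ⋆` and the sharp involution -/

/-- The permutation `σ⋆ = rev σ⁻¹ rev` indexing the image `ι(P_σ) = P_{σ⋆}` of a permutation matrix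
under the Gelfand–Kazhdan involution. [folklore] -/
def starPerm (σ : Equiv.Perm (Fin n)) : Equiv.Perm (Fin n) := Fin.revPerm * σ⁻¹ * Fin.revPerm

/-- `σ⋆ i = rev (σ⁻¹ (rev i))`. [folklore] -/
lemma starPerm_apply (σ : Equiv.Perm (Fin n)) (i : Fin n) :
    starPerm σ i = Fin.rev (σ.symm (Fin.rev i)) := rfl

/-- `σ⋆⋆ = σ`. [folklore] -/
@[simp] lemma starPerm_starPerm (σ : Equiv.Perm (Fin n)) : starPerm (starPerm σ) = σ := by
  ext i
  simp [starPerm, Equiv.Perm.mul_apply, Equiv.Perm.inv_def]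

/-- `starPerm` is injective. [folklore] -/
lemma starPerm_injective : Function.Injective (starPerm (n := n)) := fun σ τ h => by
  rw [← starPerm_starPerm σ, h, starPerm_starPerm]

/-- The long Weyl element is the permutation matrix of `rev`. [folklore] -/
lemma weylLong_eq_permGL : weylLong n K = permGL Fin.revPerm := Units.ext (coe_weylLong n K)

/-- The element `m₀ = P_σ w⁰` conjugating the torus coordinate of `ι(g)` to that of `g`.
[folklore] -/
noncomputable def cellSharpElt (σ : Equiv.Perm (Fin n)) : GL (Fin n) K := permGL σ * weylLong n K

/-- The **sharp involution** `x ↦ m₀ x m₀⁻¹` of `GL_n(K)` attached to `σ`, `m₀ = P_σ w⁰`; for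
`σ⋆ = σ` it is the transformation of torus coordinates induced by `ι` on the cell `C_σ`. [folklore] -/
noncomputable def cellSharp (σ : Equiv.Perm (Fin n)) (x : GL (Fin n) K) : GL (Fin n) K :=
  cellSharpElt σ * x * (cellSharpElt σ)⁻¹

/-- `cellSharp σ (diag e) = diag(e ∘ rev ∘ σ)`. [folklore] -/
theorem cellSharp_diagonalGL (σ : Equiv.Perm (Fin n)) (e : Fin n → Kˣ) :
    cellSharp σ (diagonalGL (Fin n) K e) = diagonalGL (Fin n) K ((e ∘ Fin.rev) ∘ σ) := by
  have h1 : (permGL Fin.revPerm : GL (Fin n) K) * diagonalGL (Fin n) K e * (permGL Fin.revPerm)⁻¹ =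
      diagonalGL (Fin n) K (e ∘ Fin.rev) :=
    permGL_mul_diagonalGL_mul_permGL_inv Fin.revPerm e
  rw [cellSharp, cellSharpElt, weylLong_eq_permGL, _root_.mul_inv_rev,
    ← permGL_mul_diagonalGL_mul_permGL_inv σ (e ∘ Fin.rev), ← h1]
  simp only [mul_assoc]

/-- For `σ⋆ = σ`, `rev σ rev σ = 1`. [folklore] -/
lemma rev_mul_mul_rev_mul_eq_one {σ : Equiv.Perm (Fin n)} (hσ : starPerm σ = σ) :
    Fin.revPerm * σ * Fin.revPerm * σ = 1 := by
  have h : Fin.revPerm * σ⁻¹ * Fin.revPerm = σ := hσ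
  calc Fin.revPerm * σ * Fin.revPerm * σ = Fin.revPerm * σ * Fin.revPerm * (Fin.revPerm * σ⁻¹ * Fin.revPerm) := by
        rw [h]
    _ = 1 := by
        have hr : (Fin.revPerm : Equiv.Perm (Fin n)) * Fin.revPerm = 1 := by
          ext i; simp [Equiv.Perm.mul_apply]
        calc Fin.revPerm * σ * Fin.revPerm * (Fin.revPerm * σ⁻¹ * Fin.revPerm)
            = Fin.revPerm * σ * (Fin.revPerm * Fin.revPerm) * σ⁻¹ * Fin.revPerm := by group
          _ = 1 := by rw [hr, mul_one, mul_inv_cancel_right, hr]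

/-- **`m₀² = 1` for `σ⋆ = σ`.** [folklore] -/
theorem cellSharpElt_mul_self {σ : Equiv.Perm (Fin n)} (hσ : starPerm σ = σ) :
    (cellSharpElt σ : GL (Fin n) K) * cellSharpElt σ = 1 := by
  rw [cellSharpElt, weylLong_eq_permGL, permGL_mul_permGL, permGL_mul_permGL, ← mul_assoc,
    rev_mul_mul_rev_mul_eq_one hσ, permGL_one]

/-- For `σ⋆ = σ`, `m₀⁻¹ = m₀`. [folklore] -/
theorem cellSharpElt_inv {σ : Equiv.Perm (Fin n)} (hσ : starPerm σ = σ) :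
    (cellSharpElt σ : GL (Fin n) K)⁻¹ = cellSharpElt σ :=
  inv_eq_of_mul_eq_one_right (cellSharpElt_mul_self hσ)

/-- **The sharp map is an involution** for `σ⋆ = σ`. [folklore] -/
theorem cellSharp_cellSharp {σ : Equiv.Perm (Fin n)} (hσ : starPerm σ = σ) (x : GL (Fin n) K) :
    cellSharp σ (cellSharp σ x) = x := by
  rw [cellSharp, cellSharp, cellSharpElt_inv hσ]
  calc cellSharpElt σ * (cellSharpElt σ * x * cellSharpElt σ) * cellSharpElt σ
      = (cellSharpElt σ * cellSharpElt σ) * x * (cellSharpElt σ * cellSharpElt σ) := by group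
    _ = x := by rw [cellSharpElt_mul_self hσ, one_mul, mul_one]


/-! ### The Gelfand–Kazhdan involution on `B`, on permutation matrices and on the cells -/

section Involution

variable [TopologicalSpace K]

omit [TopologicalSpace K] in
/-- `borelTorus b = diag(e)` when the diagonal entries of `b` are the `e i`. [folklore] -/
theorem borelTorus_eq_diagonalGL {b : GL (Fin n) K}
    (hb : b ∈ standardParabolicGL K (_root_.id : Fin n → Fin n)) {e : Fin n → Kˣ}
    (he : diagEntries b = fun i => (e i : K)) : borelTorus b hb = diagonalGL (Fin n) K e := by
  apply Units.ext
  rw [coe_borelTorus, coe_diagonalGL, he]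

/-- **`ι(P_σ) = P_{σ⋆}`.** [folklore] -/
theorem gkInvolution_permGL (σ : Equiv.Perm (Fin n)) :
    gkInvolution (permGL σ : GL (Fin n) K) = permGL (starPerm σ) := by
  apply Units.ext
  ext i j
  rw [coe_gkInvolution_apply, coe_permGL, coe_permGL, permMatrix_apply', permMatrix_apply',
    starPerm_apply]
  have : σ (Fin.rev j) = Fin.rev i ↔ Fin.rev (σ.symm (Fin.rev i)) = j := by
    constructor
    · intro h; rw [← h, Equiv.symm_apply_apply, Fin.rev_rev]
    · intro h; rw [← h, Fin.rev_rev, Equiv.apply_symm_apply]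
  by_cases h : σ (Fin.rev j) = Fin.rev i
  · rw [if_pos h, if_pos (this.1 h)]
  · rw [if_neg h, if_neg (fun h' => h (this.2 h'))]

/-- **`ι(B) = B`**: the involution preserves the upper triangular group. [folklore] -/
theorem gkInvolution_mem_borel {b : GL (Fin n) K}
    (hb : b ∈ standardParabolicGL K (_root_.id : Fin n → Fin n)) :
    gkInvolution b ∈ standardParabolicGL K (_root_.id : Fin n → Fin n) := by
  intro i j hij
  rw [coe_gkInvolution_apply]
  exact hb (Fin.rev_lt_rev.2 hij)

/-- `diag(ι b) = diag(b) ∘ rev` for `b ∈ B` (indeed for every `b`). [folklore] -/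
theorem diagEntries_gkInvolution (b : GL (Fin n) K) :
    diagEntries (gkInvolution b) = diagEntries b ∘ Fin.rev := by
  funext i
  rw [diagEntries_apply, coe_gkInvolution_apply, Function.comp_apply, diagEntries_apply]

/-- **`ι(diag d) = diag(d ∘ rev)`.** [folklore] -/
theorem gkInvolution_diagonalGL (d : Fin n → Kˣ) :
    gkInvolution (diagonalGL (Fin n) K d) = diagonalGL (Fin n) K (d ∘ Fin.rev) := by
  apply Units.ext
  ext i j
  rw [coe_gkInvolution_apply, coe_diagonalGL, coe_diagonalGL]
  by_cases h : i = j
  · subst h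
    rw [Matrix.diagonal_apply_eq, Matrix.diagonal_apply_eq, Function.comp_apply]
  · rw [Matrix.diagonal_apply_ne _ (fun h' => h (Fin.rev_injective h').symm),
      Matrix.diagonal_apply_ne _ h]

/-- `ι` maps the cell of `σ` into the cell of `σ⋆` (`ι(b P_σ u) = ι(u) P_{σ⋆} ι(b)` and
`U P B = B P U`). [folklore] -/
theorem gkInvolution_mem_bruhatCell {σ : Equiv.Perm (Fin n)} {g : GL (Fin n) K}
    (hg : g ∈ bruhatCell (K := K) σ) : gkInvolution g ∈ bruhatCell (K := K) (starPerm σ) := by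
  obtain ⟨b, hb, u, hu, rfl⟩ := hg
  have hιb := gkInvolution_mem_borel hb
  set T := borelTorus (gkInvolution b) hιb with hT
  obtain ⟨e, he⟩ : ∃ e : Fin n → Kˣ, diagonalGL (Fin n) K e = T := ⟨_, rfl⟩
  -- `ι(g) = (ι u · P⋆ T P⋆⁻¹) · P⋆ · (T⁻¹ ι b)`
  refine ⟨gkInvolution u * (permGL (starPerm σ) * T * (permGL (starPerm σ))⁻¹), ?_,
    T⁻¹ * gkInvolution b, borelTorus_inv_mul_mem_upperUnitriangular hιb, ?_⟩
  · refine Subgroup.mul_mem _ (upperUnitriangular_le_borel (gkInvolution_mem_upperUnitriangular hu)) ?_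
    rw [← he, permGL_mul_diagonalGL_mul_permGL_inv]
    exact diagonalGL_mem_borel _
  · rw [gkInvolution_mul, gkInvolution_mul, gkInvolution_permGL]
    group

/-- **`ι(C_σ) = C_{σ⋆}`**: `ι g ∈ C_{σ⋆} ↔ g ∈ C_σ`. [folklore] -/
theorem gkInvolution_mem_bruhatCell_iff (σ : Equiv.Perm (Fin n)) (g : GL (Fin n) K) :
    gkInvolution g ∈ bruhatCell (K := K) (starPerm σ) ↔ g ∈ bruhatCell (K := K) σ := by
  refine ⟨fun h => ?_, gkInvolution_mem_bruhatCell⟩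
  have := gkInvolution_mem_bruhatCell h
  rwa [gkInvolution_gkInvolution, starPerm_starPerm] at this

/-- `ι(d) = w⁰ d w⁰` for diagonal `d`: `ι(diag e) P_σ⋯`; precisely `P_σ ι(diag e) P_σ⁻¹ = cellSharp σ (diag e)`.
[folklore] -/
theorem permGL_mul_gkInvolution_diagonalGL_mul_permGL_inv (σ : Equiv.Perm (Fin n)) (e : Fin n → Kˣ) :
    (permGL σ : GL (Fin n) K) * gkInvolution (diagonalGL (Fin n) K e) * (permGL σ)⁻¹ =
      cellSharp σ (diagonalGL (Fin n) K e) := by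
  rw [gkInvolution_diagonalGL, permGL_mul_diagonalGL_mul_permGL_inv, cellSharp_diagonalGL]

/-- **The torus coordinate of `ι(g)`** on an `ι`-stable cell (`σ⋆ = σ`): writing
`g = u₁ d P_σ u₂`, `ι(g) = ι(u₂) P_σ ι(d) ι(u₁) = (ι(u₂) · P_σ ι(d) P_σ⁻¹) P_σ ι(u₁)`, so
`cellTorus σ (ι g) = P_σ w⁰ d w⁰ P_σ⁻¹ = cellSharp σ d`. [folklore] -/
theorem cellTorus_gkInvolution {σ : Equiv.Perm (Fin n)} (hσ : starPerm σ = σ) {g : GL (Fin n) K}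
    (hg : g ∈ bruhatCell (K := K) σ) :
    cellTorus σ (gkInvolution g) = cellSharp σ (cellTorus σ g) := by
  obtain ⟨u₁, hu₁, u₂, hu₂, h⟩ := exists_eq_mul_cellTorus_mul σ hg
  obtain ⟨e, he⟩ := exists_diagonalGL_eq_cellTorus (K := K) σ g
  have hD : (permGL σ : GL (Fin n) K) * gkInvolution (cellTorus σ g) * (permGL σ)⁻¹ =
      cellSharp σ (cellTorus σ g) := by
    rw [← he, permGL_mul_gkInvolution_diagonalGL_mul_permGL_inv]
  have hDB : (permGL σ : GL (Fin n) K) * gkInvolution (cellTorus σ g) * (permGL σ)⁻¹ ∈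
      standardParabolicGL K (_root_.id : Fin n → Fin n) := by
    rw [hD, ← he, cellSharp_diagonalGL]; exact diagonalGL_mem_borel _
  have hb : gkInvolution u₂ * ((permGL σ : GL (Fin n) K) * gkInvolution (cellTorus σ g) * (permGL σ)⁻¹) ∈
      standardParabolicGL K (_root_.id : Fin n → Fin n) :=
    Subgroup.mul_mem _ (upperUnitriangular_le_borel (gkInvolution_mem_upperUnitriangular hu₂)) hDB
  have hι : gkInvolution g =
      gkInvolution u₂ * ((permGL σ : GL (Fin n) K) * gkInvolution (cellTorus σ g) * (permGL σ)⁻¹) *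
        permGL σ * gkInvolution u₁ := by
    conv_lhs => rw [h]
    rw [gkInvolution_mul, gkInvolution_mul, gkInvolution_mul, gkInvolution_permGL, hσ]
    group
  rw [hι, cellTorus_eq σ hb (gkInvolution_mem_upperUnitriangular hu₁)]
  have hdiag : diagEntries (gkInvolution u₂ *
      ((permGL σ : GL (Fin n) K) * gkInvolution (cellTorus σ g) * (permGL σ)⁻¹)) =
      fun i => (((e ∘ Fin.rev) ∘ σ) i : K) := by
    rw [diagEntries_upperUnitriangular_mul (gkInvolution_mem_upperUnitriangular hu₂) hDB, hD, ← he,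
      cellSharp_diagonalGL, diagEntries_diagonalGL]
  rw [borelTorus_eq_diagonalGL hb hdiag, ← he, cellSharp_diagonalGL]

/-- **`ι` of the monomial representative**: on an `ι`-stable cell,
`ι(d P_σ) = (cellTorus σ (ι g)) P_σ` for `d = cellTorus σ g`, so the representative of the orbit of
`ι(g)` is `ι` of the representative of the orbit of `g`. [folklore] -/
theorem gkInvolution_cellTorus_mul_permGL {σ : Equiv.Perm (Fin n)} (hσ : starPerm σ = σ) {g : GL (Fin n) K}
    (hg : g ∈ bruhatCell (K := K) σ) :
    gkInvolution (cellTorus σ g * permGL σ) = cellTorus σ (gkInvolution g) * permGL σ := by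
  obtain ⟨e, he⟩ := exists_diagonalGL_eq_cellTorus (K := K) σ g
  rw [gkInvolution_mul, gkInvolution_permGL, hσ, cellTorus_gkInvolution hσ hg, ← he,
    ← permGL_mul_gkInvolution_diagonalGL_mul_permGL_inv, inv_mul_cancel_right]

/-- On an `ι`-stable cell, `ι` fixes the representative `d P_σ` iff the sharp map fixes `d`.
[folklore] -/
theorem gkInvolution_cellTorus_mul_permGL_eq_iff {σ : Equiv.Perm (Fin n)} (hσ : starPerm σ = σ)
    {g : GL (Fin n) K} (hg : g ∈ bruhatCell (K := K) σ) :
    gkInvolution (cellTorus σ g * permGL σ) = cellTorus σ g * permGL σ ↔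
      cellSharp σ (cellTorus σ g) = cellTorus σ g := by
  rw [gkInvolution_cellTorus_mul_permGL hσ hg, ← cellTorus_gkInvolution hσ hg]
  exact ⟨fun h => mul_right_cancel h, fun h => by rw [h]⟩

end Involution

/-! ### The rank sum of a permutation and its invariance under `σ ↦ σ⋆` -/

section RankSum

/-- `[p ∧ q] = [p] [q]` for `ℕ`-valued indicators. [folklore] -/
private lemma boole_and (p q : Prop) [Decidable p] [Decidable q] :
    (if p ∧ q then (1 : ℕ) else 0) = (if p then 1 else 0) * (if q then 1 else 0) := by
  by_cases hp : p <;> by_cases hq : q <;> simp [hp, hq]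

/-- `#{a : Fin n | a ≤ i} = i + 1`. [folklore] -/
private lemma sum_boole_le (i : Fin n) : (∑ a : Fin n, if a ≤ i then (1 : ℕ) else 0) = (i : ℕ) + 1 := by
  rw [Finset.sum_boole, Nat.cast_id]
  have : (Finset.univ.filter fun a : Fin n => a ≤ i) = Finset.Iic i := by
    ext a; simp
  rw [this, Fin.card_Iic]

/-- `#{j ≤ n | k < j} = n - k`. [folklore] -/
private lemma sum_range_boole_lt (n k : ℕ) :
    (∑ j ∈ Finset.range (n + 1), if k < j then (1 : ℕ) else 0) = n - k := by
  rw [Finset.sum_boole, Nat.cast_id]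
  have : (Finset.range (n + 1)).filter (fun j => k < j) = Finset.Ioc k n := by
    ext j
    simp only [Finset.mem_filter, Finset.mem_range, Finset.mem_Ioc]
    omega
  rw [this, Nat.card_Ioc]

/-- **Closed form of the rank sum** for the Borel cells: `∑_{a, j ≤ n} #{i ≥ a : σ i < j} =
∑_i (i + 1)(n - σ i)` (count the triples `(a, j, i)`). [folklore] -/
theorem rankSum_id_eq (σ : Equiv.Perm (Fin n)) :
    rankSum (_root_.id : Fin n → Fin n) σ = ∑ i : Fin n, ((i : ℕ) + 1) * (n - (σ i : ℕ)) := by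
  classical
  unfold rankSum blockCount
  simp only [Finset.card_filter, _root_.id]
  -- bring the sum over `i` outside
  have h1 : ∀ a : Fin n, (∑ j ∈ Finset.range (n + 1), ∑ i : Fin n,
      if a ≤ i ∧ ((σ i : Fin n) : ℕ) < j then (1 : ℕ) else 0) =
      ∑ i : Fin n, ∑ j ∈ Finset.range (n + 1), if a ≤ i ∧ ((σ i : Fin n) : ℕ) < j then (1 : ℕ) else 0 :=
    fun a => Finset.sum_comm
  simp only [h1]
  rw [Finset.sum_comm]
  refine Finset.sum_congr rfl fun i _ => ?_
  simp only [boole_and]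
  rw [← sum_boole_le i, ← sum_range_boole_lt n (σ i : ℕ), Finset.sum_mul_sum]

/-- **The rank sum is invariant under `σ ↦ σ⋆ = rev σ⁻¹ rev`** (equivalently under the
Gelfand–Kazhdan involution of the cells): `∑_i (i+1)(n - σ⋆ i) = ∑_i (i+1)(σ⁻¹(rev i) + 1)
= ∑_i (n - i)(σ⁻¹ i + 1) = ∑_l (n - σ l)(l + 1)`. [folklore] -/
theorem rankSum_starPerm (σ : Equiv.Perm (Fin n)) :
    rankSum (_root_.id : Fin n → Fin n) (starPerm σ) = rankSum (_root_.id : Fin n → Fin n) σ := by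
  rw [rankSum_id_eq, rankSum_id_eq]
  have h1 : ∀ i : Fin n, n - ((starPerm σ i : Fin n) : ℕ) = ((σ.symm (Fin.rev i) : Fin n) : ℕ) + 1 := by
    intro i
    rw [starPerm_apply, Fin.val_rev]
    have := (σ.symm (Fin.rev i)).isLt
    omega
  simp only [h1]
  calc ∑ i : Fin n, ((i : ℕ) + 1) * (((σ.symm (Fin.rev i) : Fin n) : ℕ) + 1)
      = ∑ i : Fin n, ((Fin.rev i : ℕ) + 1) * (((σ.symm i : Fin n) : ℕ) + 1) := by
        rw [← Equiv.sum_comp Fin.revPerm]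
        refine Finset.sum_congr rfl fun i _ => ?_
        rw [Fin.revPerm_apply, Fin.rev_rev]
    _ = ∑ l : Fin n, ((Fin.rev (σ l) : ℕ) + 1) * ((l : ℕ) + 1) := by
        rw [← Equiv.sum_comp σ]
        refine Finset.sum_congr rfl fun l _ => ?_
        rw [Equiv.symm_apply_apply]
    _ = ∑ i : Fin n, ((i : ℕ) + 1) * (n - ((σ i : Fin n) : ℕ)) := by
        refine Finset.sum_congr rfl fun l _ => ?_
        rw [Fin.val_rev, mul_comm]
        have := (σ l).isLt
        congr 1
        omega

end RankSum

/-! ### The closed filtration of `GL_n` by the rank sums of the cells -/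

section Levels

/-- For the trivial labelling, the cell determines the permutation. [folklore] -/
theorem eq_of_bruhatCell_eq {σ τ : Equiv.Perm (Fin n)}
    (h : bruhatCell (K := K) σ = bruhatCell (K := K) τ) : σ = τ := by
  have hmem : (permGL σ : GL (Fin n) K) ∈ bruhatCell (K := K) τ := by
    rw [← h]; exact permGL_mem_parabolicDoubleCoset (K := K) _ σ
  have h2 : (_root_.id : Fin n → Fin n) ∘ σ.symm = _root_.id ∘ τ.symm :=
    comp_symm_eq_of_blockCount_eq _ (blockCount_eq_of_permGL_mem _ hmem)
  have h3 : σ.symm = τ.symm := Equiv.ext fun i => congrFun h2 i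
  simpa using congrArg Equiv.symm h3

/-- Distinct permutations have disjoint cells. [folklore] -/
theorem disjoint_bruhatCell {σ τ : Equiv.Perm (Fin n)} (h : σ ≠ τ) :
    Disjoint (bruhatCell (K := K) σ) (bruhatCell (K := K) τ) :=
  (parabolicDoubleCoset_eq_or_disjoint (K := K) _ monotone_id σ τ).resolve_left
    fun h' => h (eq_of_bruhatCell_eq h')

/-- Every `g` lies in some cell (Bruhat decomposition). [folklore] -/
theorem exists_mem_bruhatCell (g : GL (Fin n) K) : ∃ σ : Equiv.Perm (Fin n), g ∈ bruhatCell (K := K) σ := by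
  have := Set.mem_univ g
  rw [← iUnion_parabolicDoubleCoset (K := K) (_root_.id : Fin n → Fin n) monotone_id, Set.mem_iUnion] at this
  exact this

/-- The **level** `levelLT r = ⋃_{rankSum σ < r} C_σ`: the union of the cells of rank sum `< r`
(`cellsBelow` of `ParabolicBruhatCellsTopology` for the lower set of keys with first component
`< r`). [folklore] -/
def levelLT (r : ℕ) : Set (GL (Fin n) K) :=
  cellsBelow (K := K) (_root_.id : Fin n → Fin n) {k | (ofLex k).1 < r}

/-- Membership in a level. [folklore] -/
theorem mem_levelLT_iff (r : ℕ) (g : GL (Fin n) K) :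
    g ∈ levelLT (K := K) r ↔ ∃ τ : Equiv.Perm (Fin n),
      rankSum (_root_.id : Fin n → Fin n) τ < r ∧ g ∈ bruhatCell (K := K) τ := by
  rw [levelLT, mem_cellsBelow_iff]
  rfl

/-- `levelLT 0 = ∅`. [folklore] -/
@[simp] theorem levelLT_zero : levelLT (K := K) (n := n) 0 = ∅ := by
  ext g
  simp [mem_levelLT_iff]

/-- The levels increase. [folklore] -/
theorem levelLT_mono {r r' : ℕ} (h : r ≤ r') : levelLT (K := K) (n := n) r ⊆ levelLT (K := K) r' :=
  fun g hg => by
    obtain ⟨τ, hτ, hg⟩ := (mem_levelLT_iff r g).1 hg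
    exact (mem_levelLT_iff r' g).2 ⟨τ, lt_of_lt_of_le hτ h, hg⟩

/-- A cell lies in the level just above its rank sum. [folklore] -/
theorem bruhatCell_subset_levelLT_succ (σ : Equiv.Perm (Fin n)) :
    bruhatCell (K := K) σ ⊆ levelLT (K := K) (rankSum (_root_.id : Fin n → Fin n) σ + 1) :=
  fun g hg => (mem_levelLT_iff _ g).2 ⟨σ, Nat.lt_succ_self _, hg⟩

/-- A cell does not meet the level of its own rank sum. [folklore] -/
theorem disjoint_bruhatCell_levelLT (σ : Equiv.Perm (Fin n)) :
    Disjoint (bruhatCell (K := K) σ) (levelLT (K := K) (rankSum (_root_.id : Fin n → Fin n) σ)) := by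
  rw [Set.disjoint_left]
  intro g hg hg'
  obtain ⟨τ, hτ, hgτ⟩ := (mem_levelLT_iff _ g).1 hg'
  have hne : σ ≠ τ := fun h => by rw [h] at hτ; exact lt_irrefl _ hτ
  exact Set.disjoint_left.1 (disjoint_bruhatCell (K := K) hne) hg hgτ

/-- **Decomposition of a level step**: a point of `levelLT (r + 1)` lies in `levelLT r` or in a
cell of rank sum exactly `r`. [folklore] -/
theorem mem_levelLT_succ_iff (r : ℕ) (g : GL (Fin n) K) :
    g ∈ levelLT (K := K) (r + 1) ↔ g ∈ levelLT (K := K) r ∨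
      ∃ τ : Equiv.Perm (Fin n), rankSum (_root_.id : Fin n → Fin n) τ = r ∧ g ∈ bruhatCell (K := K) τ := by
  rw [mem_levelLT_iff, mem_levelLT_iff]
  constructor
  · rintro ⟨τ, hτ, hg⟩
    rcases Nat.lt_succ_iff_lt_or_eq.1 hτ with h | h
    · exact Or.inl ⟨τ, h, hg⟩
    · exact Or.inr ⟨τ, h, hg⟩
  · rintro (⟨τ, hτ, hg⟩ | ⟨τ, hτ, hg⟩)
    · exact ⟨τ, Nat.lt_succ_of_lt hτ, hg⟩
    · exact ⟨τ, hτ ▸ Nat.lt_succ_self _, hg⟩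

/-- **The levels exhaust `GL_n`**: `levelLT r = GL_n(K)` as soon as `r` exceeds every rank sum.
[folklore] -/
theorem levelLT_eq_univ {r : ℕ} (hr : ∀ τ : Equiv.Perm (Fin n), rankSum (_root_.id : Fin n → Fin n) τ < r) :
    levelLT (K := K) (n := n) r = Set.univ :=
  Set.eq_univ_of_forall fun g => by
    obtain ⟨σ, hσ⟩ := exists_mem_bruhatCell (K := K) g
    exact (mem_levelLT_iff r g).2 ⟨σ, hr σ, hσ⟩

/-- A bound exceeding every rank sum. [folklore] -/
theorem rankSum_lt_sup_succ (τ : Equiv.Perm (Fin n)) :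
    rankSum (_root_.id : Fin n → Fin n) τ <
      (Finset.univ.sup fun σ : Equiv.Perm (Fin n) => rankSum (_root_.id : Fin n → Fin n) σ) + 1 :=
  Nat.lt_succ_of_le (Finset.le_sup (f := fun σ : Equiv.Perm (Fin n) =>
    rankSum (_root_.id : Fin n → Fin n) σ) (Finset.mem_univ τ))

/-- **The levels are stable under `g ↦ u₁ g u₂`**, `u₁, u₂ ∈ U_n`. [folklore] -/
theorem mul_mul_mem_levelLT {r : ℕ} {g u₁ u₂ : GL (Fin n) K} (hg : g ∈ levelLT (K := K) r)
    (hu₁ : u₁ ∈ upperUnitriangular (Fin n) K) (hu₂ : u₂ ∈ upperUnitriangular (Fin n) K) :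
    u₁ * g * u₂ ∈ levelLT (K := K) r :=
  mul_mul_mem_cellsBelow _ hg (upperUnitriangular_le_borel hu₁) hu₂

variable [TopologicalSpace K]

/-- **The levels are stable under the Gelfand–Kazhdan involution** (`ι(C_τ) = C_{τ⋆}` and
`rankSum τ⋆ = rankSum τ`). [folklore] -/
theorem gkInvolution_mem_levelLT {r : ℕ} {g : GL (Fin n) K} (hg : g ∈ levelLT (K := K) r) :
    gkInvolution g ∈ levelLT (K := K) r := by
  obtain ⟨τ, hτ, hgτ⟩ := (mem_levelLT_iff r g).1 hg
  exact (mem_levelLT_iff r _).2 ⟨starPerm τ, by rwa [rankSum_starPerm], gkInvolution_mem_bruhatCell hgτ⟩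

/-- `ι g ∈ levelLT r ↔ g ∈ levelLT r`. [folklore] -/
theorem gkInvolution_mem_levelLT_iff (r : ℕ) (g : GL (Fin n) K) :
    gkInvolution g ∈ levelLT (K := K) r ↔ g ∈ levelLT (K := K) r :=
  ⟨fun h => by simpa using gkInvolution_mem_levelLT h, gkInvolution_mem_levelLT⟩

variable [IsTopologicalRing K] [T1Space K]

/-- **The levels are closed** (`isClosed_cellsBelow` for the lower set `{k | k.1 < r}` of keys).
[cite: FultonYoungTableaux1997, §10.2 (PDF p. 152)] -/
theorem isClosed_levelLT (r : ℕ) : IsClosed (levelLT (K := K) (n := n) r) := by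
  refine isClosed_cellsBelow _ monotone_id fun k k' hk'k hk => ?_
  change (ofLex k').1 < r
  have hk : (ofLex k).1 < r := hk
  rcases Prod.Lex.le_iff.1 (show toLex (ofLex k') ≤ toLex (ofLex k) from hk'k) with h | ⟨h, -⟩
  · exact lt_trans h hk
  · exact h ▸ hk

/-- **Each cell is relatively open in the level above it**: every `g ∈ C_σ` has a neighbourhood
`N` with `N ∩ levelLT (rankSum σ + 1) ⊆ C_σ`. Near `g` all south-west ranks are at least those of
`g` (lower semicontinuity, `isOpen_setOf_le_swRank`); a nearby point of a cell `C_τ` with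
`rankSum τ ≤ rankSum σ` and `blockCount τ ≥ blockCount σ` has the block counts of `σ`.
[cite: FultonYoungTableaux1997, §10.2 (PDF p. 152)] -/
theorem exists_isOpen_inter_levelLT_subset (σ : Equiv.Perm (Fin n)) {g : GL (Fin n) K}
    (hg : g ∈ bruhatCell (K := K) σ) :
    ∃ N : Set (GL (Fin n) K), IsOpen N ∧ g ∈ N ∧
      N ∩ levelLT (K := K) (rankSum (_root_.id : Fin n → Fin n) σ + 1) ⊆ bruhatCell (K := K) σ := by
  classical
  have hσ : swRank (_root_.id : Fin n → Fin n) (g : Matrix (Fin n) (Fin n) K) = blockCount _root_.id σ :=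
    (mem_parabolicDoubleCoset_iff_swRank_eq (K := K) _ monotone_id σ g).1 hg
  set N : Set (GL (Fin n) K) := ⋂ a : Fin n, ⋂ j ∈ Finset.range (n + 1),
    {g' : GL (Fin n) K | swRank (_root_.id : Fin n → Fin n) (g : Matrix (Fin n) (Fin n) K) a j ≤
      swRank (_root_.id : Fin n → Fin n) (g' : Matrix (Fin n) (Fin n) K) a j} with hN
  refine ⟨N, isOpen_iInter_of_finite fun a => isOpen_biInter_finset fun j _ =>
    isOpen_setOf_le_swRank _ a j _, ?_, ?_⟩
  · simp only [hN, Set.mem_iInter, Set.mem_setOf_eq]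
    exact fun _ _ _ => le_rfl
  · rintro g' ⟨hg'N, hg'L⟩
    obtain ⟨τ, hτ, hg'τ⟩ := (mem_levelLT_iff _ g').1 hg'L
    have hτ' : swRank (_root_.id : Fin n → Fin n) (g' : Matrix (Fin n) (Fin n) K) = blockCount _root_.id τ :=
      (mem_parabolicDoubleCoset_iff_swRank_eq (K := K) _ monotone_id τ g').1 hg'τ
    simp only [hN, Set.mem_iInter, Set.mem_setOf_eq] at hg'N
    have hle : ∀ a, ∀ j ≤ n, blockCount (_root_.id : Fin n → Fin n) σ a j ≤ blockCount _root_.id τ a j := by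
      intro a j hj
      have := hg'N a j (Finset.mem_range.2 (Nat.lt_succ_iff.2 hj))
      rwa [hσ, hτ'] at this
    have hb := blockCount_eq_of_le_of_rankSum_le _ hle (Nat.lt_succ_iff.1 hτ)
    rw [show bruhatCell (K := K) σ = bruhatCell (K := K) τ from
      parabolicDoubleCoset_eq_of_blockCount_eq _ monotone_id hb]
    exact hg'τ

end Levels

end Field

/-! ### Over a local field: continuity of the torus coordinate and uniform compactness -/

section LocalField

variable {F : Type*} [Field F] [ValuativeRel F] [TopologicalSpace F] [IsNonarchimedeanLocalField F]
  {n : ℕ}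

attribute [local instance] parabolicCellAction

/-- `b ↦ diag(b)` is continuous on `B`. [folklore] -/
theorem continuous_borelTorus :
    Continuous fun b : ↥(standardParabolicGL F (_root_.id : Fin n → Fin n)) =>
      borelTorus (b : GL (Fin n) F) b.2 := by
  have hdiag : Continuous fun b : ↥(standardParabolicGL F (_root_.id : Fin n → Fin n)) =>
      diagEntries (b : GL (Fin n) F) :=
    continuous_pi fun i =>
      (Units.continuous_val.matrix_elem i i).comp continuous_subtype_val
  rw [Units.continuous_iff]
  constructor
  · have : (Units.val ∘ fun b : ↥(standardParabolicGL F (_root_.id : Fin n → Fin n)) =>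
        borelTorus (b : GL (Fin n) F) b.2) =
        fun b : ↥(standardParabolicGL F (_root_.id : Fin n → Fin n)) =>
          Matrix.diagonal (diagEntries (b : GL (Fin n) F)) :=
      funext fun b => coe_borelTorus _ b.2
    rw [this]
    exact hdiag.matrix_diagonal
  · have : (fun b : ↥(standardParabolicGL F (_root_.id : Fin n → Fin n)) =>
        (((borelTorus (b : GL (Fin n) F) b.2)⁻¹ : GL (Fin n) F) : Matrix (Fin n) (Fin n) F)) =
        fun b : ↥(standardParabolicGL F (_root_.id : Fin n → Fin n)) =>
          Matrix.diagonal fun i => (diagEntries (b : GL (Fin n) F) i)⁻¹ := by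
      funext b
      rw [borelTorus, ← map_inv, coe_diagonalGL]
      rfl
    rw [this]
    refine Continuous.matrix_diagonal (continuous_pi fun i => ?_)
    exact ((continuous_apply i).comp hdiag).inv₀ fun b => diagEntries_ne_zero b.2 i

/-- **The torus coordinate is continuous on the cell**: the orbit map
`(b, u) ↦ b P_σ u⁻¹` of `B × U_n` onto the cell is open (`isOpenMap_parabolicCellAction`), hence a
quotient map, and `cellTorus σ (b P_σ u⁻¹) = diag(b)` is continuous in `(b, u)`.
[cite: BernsteinZelevinskyASENS1977, §5.14] -/
theorem continuousOn_cellTorus (σ : Equiv.Perm (Fin n)) :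
    ContinuousOn (cellTorus σ) (bruhatCell (K := F) σ) := by
  haveI := isPretransitive_parabolicCellAction (F := F) (_root_.id : Fin n → Fin n) σ
  haveI := continuousSMul_parabolicCellAction (F := F) (_root_.id : Fin n → Fin n) σ
  rw [continuousOn_iff_continuous_restrict]
  set x₀ : ↥(bruhatCell (K := F) σ) := ⟨permGL σ, permGL_mem_parabolicDoubleCoset _ σ⟩ with hx₀
  set orb : ↥(standardParabolicGL F (_root_.id : Fin n → Fin n)) × ↥(upperUnitriangular (Fin n) F) →
      ↥(bruhatCell (K := F) σ) := fun h => h • x₀ with horb_def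
  have horb : IsOpenMap orb := isOpenMap_parabolicCellAction _ monotone_id σ x₀
  have hcont : Continuous orb := continuous_smul.comp (continuous_id.prodMk continuous_const)
  have hsurj : Function.Surjective orb := fun y => MulAction.exists_smul_eq _ x₀ y
  rw [(horb.isQuotientMap hcont hsurj).continuous_iff]
  have heq : (bruhatCell (K := F) σ).restrict (cellTorus σ) ∘ orb =
      fun h => borelTorus (h.1 : GL (Fin n) F) h.1.2 := by
    funext h
    rw [Function.comp_apply, Set.restrict_apply, horb_def]
    change cellTorus σ ((h • x₀ : ↥(bruhatCell (K := F) σ)) : GL (Fin n) F) = _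
    rw [coe_parabolicCellAction_smul, hx₀]
    exact cellTorus_eq σ h.1.2 (Subgroup.inv_mem _ h.2.2)
  rw [heq]
  exact continuous_borelTorus.comp continuous_fst

/-- **Compact subsets of a cell are uniformly compact in both unipotent directions**: if
`K_c ⊆ C_σ` is compact there is a compact `C ⊆ U_n` such that every `g ∈ K_c` is
`g = u₁ (d P_σ) u₂` with `d = cellTorus σ g` and `u₁, u₂ ∈ C`. From the tree's
`exists_isCompact_subset_parabolic_mul_permGL_mul` (`g = b P_σ v`, `v` in a compact subset of
`U_n`) and the continuity of `g ↦ cellTorus σ g` on the cell (`u₁ = g v⁻¹ P_σ⁻¹ d⁻¹`).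
[cite: BernsteinZelevinskyASENS1977, §5.14] -/
theorem exists_isCompact_forall_eq_mul_cellTorus_mul (σ : Equiv.Perm (Fin n)) {K_c : Set (GL (Fin n) F)}
    (hKc : IsCompact K_c) (hsub : K_c ⊆ bruhatCell (K := F) σ) :
    ∃ C : Set ↥(upperUnitriangular (Fin n) F), IsCompact C ∧
      ∀ g ∈ K_c, ∃ u₁ ∈ C, ∃ u₂ ∈ C,
        g = (u₁ : GL (Fin n) F) * (cellTorus σ g * permGL σ) * (u₂ : GL (Fin n) F) := by
  haveI : T2Space F := (GaloisRepresentations.IsNonarchimedeanLocalField.isLocalField F).toT2Space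
  obtain ⟨C, hC, hcov⟩ := exists_isCompact_subset_parabolic_mul_permGL_mul _ monotone_id σ hKc hsub
  -- the compact set of the `u₁ = g v⁻¹ P_σ⁻¹ (cellTorus σ g)⁻¹`
  set f : GL (Fin n) F × ↥(upperUnitriangular (Fin n) F) → GL (Fin n) F :=
    fun q => q.1 * ((q.2 : GL (Fin n) F))⁻¹ * (permGL σ)⁻¹ * (cellTorus σ q.1)⁻¹ with hf
  have hfc : ContinuousOn f (K_c ×ˢ Set.univ) := by
    refine ContinuousOn.mul ?_ ?_
    · exact ((continuous_fst.mul ((continuous_subtype_val.comp continuous_snd).inv)).mul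
        continuous_const).continuousOn
    · refine ContinuousOn.inv ?_
      exact (continuousOn_cellTorus σ).comp continuous_fst.continuousOn
        fun q hq => hsub (Set.mem_prod.1 hq).1
  have hD : IsCompact (f '' (K_c ×ˢ (C : Set ↥(upperUnitriangular (Fin n) F)))) :=
    (hKc.prod hC).image_of_continuousOn (hfc.mono (Set.prod_mono le_rfl (Set.subset_univ _)))
  have hemb : Topology.IsClosedEmbedding
      (Subtype.val : ↥(upperUnitriangular (Fin n) F) → GL (Fin n) F) :=
    (isClosed_upperUnitriangular (R := F) (n := n)).isClosedEmbedding_subtypeVal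
  refine ⟨Subtype.val ⁻¹' (f '' (K_c ×ˢ (C : Set ↥(upperUnitriangular (Fin n) F)))) ∪ C,
    (hemb.isCompact_preimage hD).union hC, fun g hg => ?_⟩
  obtain ⟨p, hp, v, hv, hgpv⟩ := hcov g hg
  have hT : cellTorus σ g = borelTorus p hp := by rw [hgpv]; exact cellTorus_eq σ hp v.2
  have hu₁ : p * (borelTorus p hp)⁻¹ ∈ upperUnitriangular (Fin n) F :=
    mul_borelTorus_inv_mem_upperUnitriangular hp
  have hfu : f (g, v) = p * (borelTorus p hp)⁻¹ := by
    rw [hf]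
    change g * ((v : GL (Fin n) F))⁻¹ * (permGL σ)⁻¹ * (cellTorus σ g)⁻¹ = _
    rw [hT, hgpv]
    group
  refine ⟨⟨_, hu₁⟩, Or.inl ⟨(g, v), Set.mk_mem_prod hg hv, hfu⟩, v, Or.inr hv, ?_⟩
  change g = p * (borelTorus p hp)⁻¹ * (cellTorus σ g * permGL σ) * (v : GL (Fin n) F)
  rw [hT, hgpv]
  group

end LocalField

end Literature.NumberTheory.Automorphic
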